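import Mathlib.Analysis.Complex.Liouville
import Mathlib.Analysis.Calculus.MeanValue
import HarnessLib

/-!
# CAUCHY ESTIMATE FOR THE MIXED SECOND DIFFERENCE ON A BIDISC — the (β) ⟹ H-currency bridge, BY KERNEL (generic complex analysis)

Cell `ym3-torus` (YM ladder rung R3 = continuum `SU(2)` Yang–Mills on the three-torus — a RUNG, NOT d = 4, NOT infinite volume, NOT a mass
gap, NOT Clay).  LEAD-20520 width seat `ym-ust-20520-w3` (gen 24); `--supports stmt-QuantumFields-20520 --as helper`, count-neutral,
definition-free, default heartbeats; no registry, binder or `Lines/` edit (registered skeleton `Lines/semiclassical_s2beta.lean` v11.4, 0∕5,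
★★OWNER RULING №36, untouched).

WHAT THIS IS.  Typing note TN-SB (ideator `ym-r3-idea-1` g26, `CURRENCY-MEMO-g26.md` §9; critic idea-crit-5 #555∕#561; LEAD-20520 №12∕№15 «price of
(β): PROCEED»; ★★OWNER RULINGS №58∕№60∕№61) records that the organ's one-bond-pair remainder clause is SIZE-BLIND and that no currency transports
it without a QUANTITATIVE SMOOTHNESS datum; recommendation (β) carries a per-height ANALYTICITY predicate (print's own datum, [Balaban1985UV3]
p.263 (c): the effective densities are analytic on the complexified small-field window) and types the v18 organ O1ᵘ-H in the HESSIAN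
(scaled-move) currency `|ΔΔR| ≤ k_{bb′}·(‖v‖∕θ)·(‖v′‖∕θ)`.  The bridge «analytic with oscillation `≤ B` on the bidisc of radius `ρ` ⟹
scaled mixed-difference letters `8B∕ρ²`» is the two-variable Cauchy estimate.  This file proves it ONCE, in Mathlib's currency, for any
`g : ℂ × ℂ → F` (normed `ℂ`-space `F`) complex-differentiable on `ball 0 ρ ×ˢ ball 0 ρ` with `‖g z − g 0‖ ≤ B` there:

* §1 one-variable tools: `norm_deriv_le_of_osc` ∕ `norm_deriv_le_of_bound` (Cauchy's estimate from an OSCILLATION resp. SUP bound on the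
  sphere ⇒ `‖deriv f c‖ ≤ M∕R`), slices of a bidisc-holomorphic function are holomorphic (`differentiableOn_slice_fst∕snd`).
* §2 ★`norm_deriv_snd_le` — `‖∂_τ g(σ, τ)‖ ≤ 4B∕ρ` for `σ ∈ ball 0 ρ`, `‖τ‖ ≤ ρ∕4`; ★`norm_sliceDiff_le` — `‖g(σ,t) − g(σ,0)‖ ≤ (4B∕ρ)·‖t‖`
  for `σ ∈ ball 0 ρ`, `‖t‖ ≤ ρ∕4` (mean value along the segment).
* §3 ★★`norm_mixedDiff_le_of_differentiableOn_bidisc` — for `‖s‖, ‖t‖ ≤ ρ∕4`: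
  `‖g(s,t) − g(s,0) − g(0,t) + g(0,0)‖ ≤ (8·B∕ρ²)·‖s‖·‖t‖` (Cauchy's estimate for `σ ↦ g(σ,t) − g(σ,0)` on the sphere of radius `ρ∕2`,
  then the mean value theorem along `[0, s]`); ★★`abs_mixedDiff_le_scaled` — the same written in the H-clause's SCALED shape with window scale
  `θ` and chart radius `ρ = r·θ`: `≤ (8B∕r²)·(‖s‖∕θ)·(‖t‖∕θ)`, and its REAL-parameter reading `abs_mixedDiff_le_scaled_real` (the organ's moves
  are real one-parameter exponential moves; the predicate (β) supplies `g` with `g(s,t) = f(U·e^{sv}@b·e^{tv′}@b′)` for real `s, t`).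

So, the hour the D-item `AnalyticPairWindowAt θ r B f` (HOME draft `O1uH_draft.lean` 479029739d3717fc; director D-REQUEST (β-1)) lands, its
letters ARE H-clause letters with `k_{bb′} := 8B∕r²` at chart radius `r∕4`, by `exact` — the per-pair DECAY of `k` is then exactly the decay of
the oscillation bound `B = B_{bb′}` the seed∕class supplies (this file is agnostic).  WHAT THIS IS NOT: nothing of Bałaban's is asserted (that the
runs' densities inhabit (β) with usable `B` is [Balaban1985UV3] p.263's claim, not formalised); O1∕O1ᵘ-H∕LIN∘∕JVAR∘, the five registered
∘-stubs, crux 20520 `FluctuationComparisonRegPrIntL` and `YM3TorusSU2` are NOT proved; no summit is proved by a helper.  R3 = SU(2) YM₃ on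
T³ — NOT d = 4, NOT infinite volume, NOT a mass gap, NOT Clay; the Yang–Mills mass gap is NOT proved.
-/

noncomputable section

open Metric Set Complex

namespace Summit.QuantumFields.YangMills.Theorems.OrganTangentBidiscMixedDifference

variable {F : Type*} [NormedAddCommGroup F] [NormedSpace ℂ F]

/-! ## §1 One-variable tools -/

/-- CAUCHY'S ESTIMATE FROM AN OSCILLATION BOUND: if `f` is complex-differentiable on a neighbourhood of the closed disc `closedBall c R` and
`‖f w − f c‖ ≤ M` on the sphere `‖w − c‖ = R`, then `‖f′(c)‖ ≤ M ∕ R` (Mathlib's `norm_deriv_le_of_forall_mem_sphere_norm_le` applied to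
`f − f c`). [folklore] -/
theorem norm_deriv_le_of_osc {f : ℂ → F} {c : ℂ} {R M : ℝ} (hR : 0 < R)
    (hd : DifferentiableOn ℂ f (closedBall c R)) (hM : ∀ w ∈ sphere c R, ‖f w - f c‖ ≤ M) :
    ‖deriv f c‖ ≤ M / R := by
  have hd' : DiffContOnCl ℂ (fun w => f w - f c) (ball c R) := by
    refine DifferentiableOn.diffContOnCl ?_
    rw [closure_ball c hR.ne']
    exact hd.sub_const _
  have key := Complex.norm_deriv_le_of_forall_mem_sphere_norm_le hR hd' hM
  have hderiv : deriv (fun w => f w - f c) c = deriv f c := by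
    rw [deriv_sub_const]
  rwa [hderiv] at key

/-- CAUCHY'S ESTIMATE FROM A SUP BOUND on the sphere, for a function complex-differentiable on the closed disc (Mathlib's
`norm_deriv_le_of_forall_mem_sphere_norm_le` with the `DiffContOnCl` side condition discharged). [folklore] -/
theorem norm_deriv_le_of_bound {f : ℂ → F} {c : ℂ} {R M : ℝ} (hR : 0 < R)
    (hd : DifferentiableOn ℂ f (closedBall c R)) (hM : ∀ w ∈ sphere c R, ‖f w‖ ≤ M) :
    ‖deriv f c‖ ≤ M / R := by
  have hd' : DiffContOnCl ℂ f (ball c R) := by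
    refine DifferentiableOn.diffContOnCl ?_
    rw [closure_ball c hR.ne']
    exact hd
  exact Complex.norm_deriv_le_of_forall_mem_sphere_norm_le hR hd' hM

/-- The first-variable slice of a bidisc-holomorphic function is holomorphic on the disc. [folklore] -/
theorem differentiableOn_slice_fst {g : ℂ × ℂ → F} {ρ : ℝ} (hg : DifferentiableOn ℂ g (ball (0 : ℂ) ρ ×ˢ ball (0 : ℂ) ρ))
    {τ : ℂ} (hτ : τ ∈ ball (0 : ℂ) ρ) : DifferentiableOn ℂ (fun σ => g (σ, τ)) (ball (0 : ℂ) ρ) := by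
  intro σ hσ
  have h1 : DifferentiableWithinAt ℂ (fun σ : ℂ => (σ, τ)) (ball (0 : ℂ) ρ) σ :=
    (differentiableAt_id.prodMk (differentiableAt_const τ)).differentiableWithinAt
  exact (hg (σ, τ) (Set.mk_mem_prod hσ hτ)).comp σ h1 (fun σ' hσ' => Set.mk_mem_prod hσ' hτ)

/-- The second-variable slice of a bidisc-holomorphic function is holomorphic on the disc. [folklore] -/
theorem differentiableOn_slice_snd {g : ℂ × ℂ → F} {ρ : ℝ} (hg : DifferentiableOn ℂ g (ball (0 : ℂ) ρ ×ˢ ball (0 : ℂ) ρ))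
    {σ : ℂ} (hσ : σ ∈ ball (0 : ℂ) ρ) : DifferentiableOn ℂ (fun τ => g (σ, τ)) (ball (0 : ℂ) ρ) := by
  intro τ hτ
  have h1 : DifferentiableWithinAt ℂ (fun τ : ℂ => (σ, τ)) (ball (0 : ℂ) ρ) τ :=
    ((differentiableAt_const σ).prodMk differentiableAt_id).differentiableWithinAt
  exact (hg (σ, τ) (Set.mk_mem_prod hσ hτ)).comp τ h1 (fun τ' hτ' => Set.mk_mem_prod hσ hτ')

/-- A closed disc of radius `ρ∕2` around a point of norm `≤ ρ∕4` lies in the open disc of radius `ρ`. [folklore] -/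
theorem closedBall_subset_ball_of_norm_le {ρ : ℝ} (hρ : 0 < ρ) {c : ℂ} (hc : ‖c‖ ≤ ρ / 4) :
    closedBall c (ρ / 2) ⊆ ball (0 : ℂ) ρ := by
  intro w hw
  rw [mem_closedBall, dist_eq_norm] at hw
  rw [mem_ball, dist_zero_right]
  calc ‖w‖ = ‖(w - c) + c‖ := by rw [sub_add_cancel]
    _ ≤ ‖w - c‖ + ‖c‖ := norm_add_le _ _
    _ ≤ ρ / 2 + ρ / 4 := add_le_add hw hc
    _ < ρ := by linarith

/-- A point of norm `≤ ρ∕4` lies in the open disc of radius `ρ`. [folklore] -/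
theorem mem_ball_of_norm_le_quarter {ρ : ℝ} (hρ : 0 < ρ) {c : ℂ} (hc : ‖c‖ ≤ ρ / 4) : c ∈ ball (0 : ℂ) ρ := by
  rw [mem_ball, dist_zero_right]; linarith

/-! ## §2 First derivatives and slice differences -/

section Bidisc

variable {g : ℂ × ℂ → F} {ρ B : ℝ}

/-- ★ `‖∂_τ g(σ, τ)‖ ≤ 4B∕ρ` for `σ` in the disc and `‖τ‖ ≤ ρ∕4`: Cauchy's estimate on the sphere of radius `ρ∕2` around `τ` (inside the
disc), with the oscillation `‖g(σ,w) − g(σ,τ)‖ ≤ ‖g(σ,w) − g 0‖ + ‖g(σ,τ) − g 0‖ ≤ 2B`. [folklore] -/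
theorem norm_deriv_snd_le (hρ : 0 < ρ) (hg : DifferentiableOn ℂ g (ball (0 : ℂ) ρ ×ˢ ball (0 : ℂ) ρ))
    (hB : ∀ z ∈ ball (0 : ℂ) ρ ×ˢ ball (0 : ℂ) ρ, ‖g z - g 0‖ ≤ B)
    {σ : ℂ} (hσ : σ ∈ ball (0 : ℂ) ρ) {τ : ℂ} (hτ : ‖τ‖ ≤ ρ / 4) :
    ‖deriv (fun τ' => g (σ, τ')) τ‖ ≤ 2 * B / (ρ / 2) := by
  have hsub := closedBall_subset_ball_of_norm_le hρ hτ
  refine norm_deriv_le_of_osc (half_pos hρ) ((differentiableOn_slice_snd hg hσ).mono hsub) ?_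
  intro w hw
  have hw' : w ∈ ball (0 : ℂ) ρ := hsub (sphere_subset_closedBall hw)
  have hτ' : τ ∈ ball (0 : ℂ) ρ := mem_ball_of_norm_le_quarter hρ hτ
  have h1 := hB (σ, w) ⟨hσ, hw'⟩
  have h2 := hB (σ, τ) ⟨hσ, hτ'⟩
  calc ‖g (σ, w) - g (σ, τ)‖ = ‖(g (σ, w) - g 0) - (g (σ, τ) - g 0)‖ := by rw [sub_sub_sub_cancel_right]
    _ ≤ ‖g (σ, w) - g 0‖ + ‖g (σ, τ) - g 0‖ := norm_sub_le _ _
    _ ≤ B + B := add_le_add h1 h2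
    _ = 2 * B := by ring

/-- ★ SLICE DIFFERENCE: `‖g(σ, t) − g(σ, 0)‖ ≤ (4B∕ρ)·‖t‖` for `σ` in the disc and `‖t‖ ≤ ρ∕4` (mean value theorem along the segment
`[0, t]`, which lies in the closed disc of radius `ρ∕4` where §2's derivative bound holds). [folklore] -/
theorem norm_sliceDiff_le (hρ : 0 < ρ) (hg : DifferentiableOn ℂ g (ball (0 : ℂ) ρ ×ˢ ball (0 : ℂ) ρ))
    (hB : ∀ z ∈ ball (0 : ℂ) ρ ×ˢ ball (0 : ℂ) ρ, ‖g z - g 0‖ ≤ B)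
    {σ : ℂ} (hσ : σ ∈ ball (0 : ℂ) ρ) {t : ℂ} (ht : ‖t‖ ≤ ρ / 4) :
    ‖g (σ, t) - g (σ, 0)‖ ≤ 2 * B / (ρ / 2) * ‖t‖ := by
  have hconv : Convex ℝ (closedBall (0 : ℂ) (ρ / 4)) := convex_closedBall _ _
  have hdiff : ∀ x ∈ closedBall (0 : ℂ) (ρ / 4), DifferentiableAt ℂ (fun τ' => g (σ, τ')) x := by
    intro x hx
    rw [mem_closedBall, dist_zero_right] at hx
    exact (differentiableOn_slice_snd hg hσ).differentiableAt (isOpen_ball.mem_nhds (mem_ball_of_norm_le_quarter hρ hx))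
  have hbound : ∀ x ∈ closedBall (0 : ℂ) (ρ / 4), ‖deriv (fun τ' => g (σ, τ')) x‖ ≤ 2 * B / (ρ / 2) := by
    intro x hx
    rw [mem_closedBall, dist_zero_right] at hx
    exact norm_deriv_snd_le hρ hg hB hσ hx
  have h0 : (0 : ℂ) ∈ closedBall (0 : ℂ) (ρ / 4) := by
    rw [mem_closedBall, dist_self]; linarith
  have ht' : t ∈ closedBall (0 : ℂ) (ρ / 4) := by rwa [mem_closedBall, dist_zero_right]
  have key := hconv.norm_image_sub_le_of_norm_deriv_le hdiff hbound h0 ht'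
  simpa using key

/-! ## §3 The mixed second difference -/

/-- ★★ **CAUCHY ESTIMATE FOR THE MIXED SECOND DIFFERENCE ON A BIDISC.**  If `g : ℂ × ℂ → F` is complex-differentiable on the open bidisc
`ball 0 ρ ×ˢ ball 0 ρ` and its oscillation from the centre is `≤ B` there, then for `‖s‖, ‖t‖ ≤ ρ∕4`:
`‖g(s,t) − g(s,0) − g(0,t) + g(0,0)‖ ≤ (8B∕ρ²)·‖s‖·‖t‖`.  Proof: the slice difference `Φ(σ) := g(σ,t) − g(σ,0)` is holomorphic on the
disc with `‖Φ‖ ≤ (4B∕ρ)‖t‖` (§2); Cauchy's estimate on spheres of radius `ρ∕2` gives `‖Φ′‖ ≤ (8B∕ρ²)‖t‖` on the closed disc of radius `ρ∕4`;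
the mean value theorem along `[0, s]` concludes. [folklore] -/
theorem norm_mixedDiff_le_of_differentiableOn_bidisc (hρ : 0 < ρ)
    (hg : DifferentiableOn ℂ g (ball (0 : ℂ) ρ ×ˢ ball (0 : ℂ) ρ))
    (hB : ∀ z ∈ ball (0 : ℂ) ρ ×ˢ ball (0 : ℂ) ρ, ‖g z - g 0‖ ≤ B)
    {s t : ℂ} (hs : ‖s‖ ≤ ρ / 4) (ht : ‖t‖ ≤ ρ / 4) :
    ‖g (s, t) - g (s, 0) - g (0, t) + g (0, 0)‖ ≤ 8 * B / ρ ^ 2 * ‖s‖ * ‖t‖ := by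
  have ht0 : t ∈ ball (0 : ℂ) ρ := mem_ball_of_norm_le_quarter hρ ht
  have h00 : (0 : ℂ) ∈ ball (0 : ℂ) ρ := mem_ball_self hρ
  -- the slice difference Φ
  set Φ : ℂ → F := fun σ => g (σ, t) - g (σ, 0) with hΦ
  have hΦd : DifferentiableOn ℂ Φ (ball (0 : ℂ) ρ) :=
    (differentiableOn_slice_fst hg ht0).sub (differentiableOn_slice_fst hg h00)
  -- its size on the whole disc
  have hΦle : ∀ σ ∈ ball (0 : ℂ) ρ, ‖Φ σ‖ ≤ 2 * B / (ρ / 2) * ‖t‖ := fun σ hσ => norm_sliceDiff_le hρ hg hB hσ ht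
  -- its derivative on the closed disc of radius ρ/4
  have hΦ' : ∀ x ∈ closedBall (0 : ℂ) (ρ / 4), ‖deriv Φ x‖ ≤ (2 * B / (ρ / 2) * ‖t‖) / (ρ / 2) := by
    intro x hx
    rw [mem_closedBall, dist_zero_right] at hx
    have hsub := closedBall_subset_ball_of_norm_le hρ hx
    refine norm_deriv_le_of_bound (half_pos hρ) (hΦd.mono hsub) ?_
    intro w hw
    exact hΦle w (hsub (sphere_subset_closedBall hw))
  have hdiff : ∀ x ∈ closedBall (0 : ℂ) (ρ / 4), DifferentiableAt ℂ Φ x := by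
    intro x hx
    rw [mem_closedBall, dist_zero_right] at hx
    exact hΦd.differentiableAt (isOpen_ball.mem_nhds (mem_ball_of_norm_le_quarter hρ hx))
  have h0 : (0 : ℂ) ∈ closedBall (0 : ℂ) (ρ / 4) := by
    rw [mem_closedBall, dist_self]; linarith
  have hs' : s ∈ closedBall (0 : ℂ) (ρ / 4) := by rwa [mem_closedBall, dist_zero_right]
  have key := (convex_closedBall (0 : ℂ) (ρ / 4)).norm_image_sub_le_of_norm_deriv_le hdiff hΦ' h0 hs'
  have hrew : Φ s - Φ 0 = g (s, t) - g (s, 0) - g (0, t) + g (0, 0) := by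
    simp only [hΦ]; abel
  rw [← hrew]
  calc ‖Φ s - Φ 0‖ ≤ (2 * B / (ρ / 2) * ‖t‖) / (ρ / 2) * ‖s - 0‖ := key
    _ = 8 * B / ρ ^ 2 * ‖s‖ * ‖t‖ := by
      rw [sub_zero]
      field_simp
      ring

/-- ★★ **THE SCALED (H-CLAUSE) SHAPE.**  With window scale `θ > 0` and chart radius `ρ = r·θ` (`r > 0`), for moves `‖s‖, ‖t‖ ≤ r·θ∕4`:
`‖g(s,t) − g(s,0) − g(0,t) + g(0,0)‖ ≤ (8B∕r²)·(‖s‖∕θ)·(‖t‖∕θ)` — the letters of TN-SB's Hessian currency with `k := 8B∕r²`, uniform in the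
window scale. [folklore] -/
theorem norm_mixedDiff_le_scaled {θ r : ℝ} (hθ : 0 < θ) (hr : 0 < r)
    (hg : DifferentiableOn ℂ g (ball (0 : ℂ) (r * θ) ×ˢ ball (0 : ℂ) (r * θ)))
    (hB : ∀ z ∈ ball (0 : ℂ) (r * θ) ×ˢ ball (0 : ℂ) (r * θ), ‖g z - g 0‖ ≤ B)
    {s t : ℂ} (hs : ‖s‖ ≤ r * θ / 4) (ht : ‖t‖ ≤ r * θ / 4) :
    ‖g (s, t) - g (s, 0) - g (0, t) + g (0, 0)‖ ≤ 8 * B / r ^ 2 * (‖s‖ / θ) * (‖t‖ / θ) := by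
  have hρ : 0 < r * θ := mul_pos hr hθ
  have key := norm_mixedDiff_le_of_differentiableOn_bidisc hρ hg hB hs ht
  calc ‖g (s, t) - g (s, 0) - g (0, t) + g (0, 0)‖ ≤ 8 * B / (r * θ) ^ 2 * ‖s‖ * ‖t‖ := key
    _ = 8 * B / r ^ 2 * (‖s‖ / θ) * (‖t‖ / θ) := by
      field_simp

/-- ★★ **REAL-PARAMETER READING** (the organ's moves are real one-parameter exponential moves `U b ↦ U b · e^{s v}`; the predicate (β)
supplies `g` agreeing with the move function at real parameters): for real `|s|, |t| ≤ r·θ∕4`,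
`‖g(s,t) − g(s,0) − g(0,t) + g(0,0)‖ ≤ (8B∕r²)·(|s|∕θ)·(|t|∕θ)`. [folklore] -/
theorem norm_mixedDiff_le_scaled_real {θ r : ℝ} (hθ : 0 < θ) (hr : 0 < r)
    (hg : DifferentiableOn ℂ g (ball (0 : ℂ) (r * θ) ×ˢ ball (0 : ℂ) (r * θ)))
    (hB : ∀ z ∈ ball (0 : ℂ) (r * θ) ×ˢ ball (0 : ℂ) (r * θ), ‖g z - g 0‖ ≤ B)
    {s t : ℝ} (hs : |s| ≤ r * θ / 4) (ht : |t| ≤ r * θ / 4) :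
    ‖g ((s : ℂ), (t : ℂ)) - g ((s : ℂ), 0) - g (0, (t : ℂ)) + g (0, 0)‖ ≤ 8 * B / r ^ 2 * (|s| / θ) * (|t| / θ) := by
  have hs' : ‖(s : ℂ)‖ ≤ r * θ / 4 := by rwa [Complex.norm_real, Real.norm_eq_abs]
  have ht' : ‖(t : ℂ)‖ ≤ r * θ / 4 := by rwa [Complex.norm_real, Real.norm_eq_abs]
  have key := norm_mixedDiff_le_scaled hθ hr hg hB hs' ht'
  rwa [Complex.norm_real, Complex.norm_real, Real.norm_eq_abs, Real.norm_eq_abs] at key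

/-- The SCALAR case written with `|·|` for a real-valued quantity carried as a complex number (the predicate (β)'s `g (s, t) = ((f Z : ℝ) : ℂ)`):
if the four values are real, the estimate bounds the real mixed second difference `|f Z − f V − f W + f U|`. [folklore] -/
theorem abs_mixedDiff_le_scaled_real {g : ℂ × ℂ → ℂ} {B θ r : ℝ} (hθ : 0 < θ) (hr : 0 < r)
    (hg : DifferentiableOn ℂ g (ball (0 : ℂ) (r * θ) ×ˢ ball (0 : ℂ) (r * θ)))
    (hB : ∀ z ∈ ball (0 : ℂ) (r * θ) ×ˢ ball (0 : ℂ) (r * θ), ‖g z - g 0‖ ≤ B)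
    {s t : ℝ} (hs : |s| ≤ r * θ / 4) (ht : |t| ≤ r * θ / 4)
    {fZ fV fW fU : ℝ} (hZ : g ((s : ℂ), (t : ℂ)) = fZ) (hV : g ((s : ℂ), 0) = fV) (hW : g (0, (t : ℂ)) = fW) (hU : g (0, 0) = fU) :
    |fZ - fV - fW + fU| ≤ 8 * B / r ^ 2 * (|s| / θ) * (|t| / θ) := by
  have key := norm_mixedDiff_le_scaled_real (g := g) hθ hr hg hB hs ht
  rw [hZ, hV, hW, hU] at key
  have hcast : ((fZ : ℂ) - fV - fW + fU) = ((fZ - fV - fW + fU : ℝ) : ℂ) := by push_cast; ring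
  rwa [hcast, Complex.norm_real, Real.norm_eq_abs] at key

end Bidisc

end Summit.QuantumFields.YangMills.Theorems.OrganTangentBidiscMixedDifference

end
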